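import Literature.NumberTheory.Sieve.SmoothParitySievedLemmas
import Literature.NumberTheory.Sieve.SmoothParityAsymptotic
import Literature.NumberTheory.Sieve.SmoothParityModelCountPositivity
import Literature.NumberTheory.Sieve.SmoothParityModelCountDensity
import Literature.NumberTheory.Sieve.SmoothParityHcSum
import HarnessLib

/-!
# The sieved lower bound for parity-class friable ternary counts: main term and small sieving primes

Topic `Literature/NumberTheory/Sieve`, namespace `Literature.NumberTheory.Sieve.SmoothArcs`; a PROVED file, the analytic
part of `SmoothParitySieved` ([Harper2016, §5]).  In the polylog regime `y = ⌊(log x)^{100000}⌋` (tied to `x`), with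
`α = α(x,y)`, `𝓜 = x^α ζ(α,y)/√(2πφ₂(α,y))`, `Mv_i = e_i^{−α}𝓜`, `X_i = x/e_i`, `Q = Mv₁Mv₂Mv₃/X₃`, and REAL NONNEGATIVE
PLATEAU profiles `p_{c_i}` (`= 1` on `[a_i, b_i]`, `= 0` below `1/4`, `|p| ≤ 1`, Lipschitz), the zeroth-order asymptotic
`parityTernary_asymptotic` gives, for all large `x` and all bounded data (`e_i ≤ E₀`, `d_i ≤ D₀`):

* the MAIN TERM `re W(X) ≥ re 𝔖 · re MC − εQ` with `re 𝔖 ≥ 2(1 − 2^{−α})³ ≥ 0.249` (`le_paritySingSeries_re`) and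
  `re MC ≥ 0.81 (b₁−a₁)(b₂−a₂) Q` (`le_parityModelCount_re_of_plateau`);
* for each SMALL SIEVING PRIME `3 ≤ p ≤ (log x)^{180}` (same `x`, scalings `e_i p ≤ (log x)^{200}`, same `α`, same `𝔖`):
  `re W(X/p) ≤ p^{1−3α}(re 𝔖 · re MC + εQ) + re 𝔖 · O((L+1)D₀E₀ Q/x)` (`re_small_prime_le`: exact rescaling
  `parityModelCount_rescale'` and the sublattice density `norm_parityModelCount_rescale_sub_le'`);
* summed with `Σ_{n ≥ 3} n^{−(3α−1)} ≤ 0.501`: `parityTernary_sieved_small`,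
  `re W(X) − Σ_{3 ≤ p ≤ (log x)^{180}} re W(X/p) ≥ (2/25)(b₁−a₁)(b₂−a₂) Q`.

The large sieving primes are handled by `SmoothParitySievedTail`, the assembly is `SmoothParitySieved`.

## References

* A. J. Harper, Compositio Math. 152 (2016), §5 [Harper2016].
* J. C. Lagarias, K. Soundararajan, Proc. LMS 104 (2012), Thm 1.3 [LagariasSoundararajan2012].
-/

noncomputable section

open Finset Real Complex Filter Topology

namespace Literature.NumberTheory.Sieve

namespace SmoothArcs

open TwistedWeight

namespace Sieved

/-- **ONE SMALL SIEVING PRIME.**  If at the scalings `e_i p` the asymptotic `‖W − 𝔖 · MC'‖ ≤ ε ΠMv'_i/(x/(e₃p))` holds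
(`Mv'_i = (e_ip)^{−α}𝓜`), then, with `r_p = p (p^{−α})³` and `MC` the model count at the scalings `e_i`,
`re W ≤ r_p (re 𝔖 · re MC + ε Q) + re 𝔖 · 1024(L+1)(d₁+d₂+1) Q (1/X₁ + 1/X₂ + 1/X₃)` (`Q = ΠMv_i/X₃`): the model count
rescales exactly to the `p`-sublattice sum (`parityModelCount_rescale'`), which has density `1/p²`
(`norm_parityModelCount_rescale_sub_le'`), and `r_p · p = p^{2−3α} ≤ 1`. [cite: Harper2016, §5] -/
theorem re_small_prime_le {σ : ℤ} (hσ : σ = 1 ∨ σ = -1) {d₁ d₂ e₁ e₂ e₃ p : ℕ} {x α M₀ ε L : ℝ}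
    {c₁ c₂ c₃ : ℤ → ℂ} {S W : ℂ} (hx : 0 < x) (hα0 : 0 ≤ α) (hα23 : 2 / 3 ≤ α) (hα1 : α ≤ 1) (hM₀ : 0 ≤ M₀)
    (he₁ : 1 ≤ e₁) (he₂ : 1 ≤ e₂) (he₃ : 1 ≤ e₃) (hp : 1 ≤ p) (hpX₁ : (p : ℝ) ≤ x / e₁) (hpX₂ : (p : ℝ) ≤ x / e₂)
    (hz₁ : ∀ v : ℝ, v ≤ 1 / 4 → profileFn c₁ v = 0) (hz₂ : ∀ v : ℝ, v ≤ 1 / 4 → profileFn c₂ v = 0)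
    (hz₃ : ∀ v : ℝ, v ≤ 1 / 4 → profileFn c₃ v = 0)
    (hle₁ : ∀ v : ℝ, ‖profileFn c₁ v‖ ≤ 1) (hle₂ : ∀ v : ℝ, ‖profileFn c₂ v‖ ≤ 1) (hle₃ : ∀ v : ℝ, ‖profileFn c₃ v‖ ≤ 1)
    (hL : 0 ≤ L) (hL₁ : ∀ v w : ℝ, ‖profileFn c₁ v - profileFn c₁ w‖ ≤ L * |v - w|)
    (hL₂ : ∀ v w : ℝ, ‖profileFn c₂ v - profileFn c₂ w‖ ≤ L * |v - w|)
    (hL₃ : ∀ v w : ℝ, ‖profileFn c₃ v - profileFn c₃ w‖ ≤ L * |v - w|)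
    (hS : S.im = 0) (hS0 : 0 ≤ S.re)
    (hAp : ‖W - S * parityModelCount σ d₁ d₂ (x / ((e₁ * p : ℕ) : ℝ)) (x / ((e₂ * p : ℕ) : ℝ)) (x / ((e₃ * p : ℕ) : ℝ))
        (((e₁ * p : ℕ) : ℝ) ^ (-α) * M₀) (((e₂ * p : ℕ) : ℝ) ^ (-α) * M₀) (((e₃ * p : ℕ) : ℝ) ^ (-α) * M₀) α c₁ c₂ c₃‖ ≤
      ε * ((((e₁ * p : ℕ) : ℝ) ^ (-α) * M₀) * (((e₂ * p : ℕ) : ℝ) ^ (-α) * M₀) * (((e₃ * p : ℕ) : ℝ) ^ (-α) * M₀)) /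
        (x / ((e₃ * p : ℕ) : ℝ))) :
    W.re ≤ (p : ℝ) * ((p : ℝ) ^ (-α)) ^ 3 *
        (S.re * (parityModelCount σ d₁ d₂ (x / e₁) (x / e₂) (x / e₃) ((e₁ : ℝ) ^ (-α) * M₀) ((e₂ : ℝ) ^ (-α) * M₀)
            ((e₃ : ℝ) ^ (-α) * M₀) α c₁ c₂ c₃).re +
          ε * (((e₁ : ℝ) ^ (-α) * M₀) * ((e₂ : ℝ) ^ (-α) * M₀) * ((e₃ : ℝ) ^ (-α) * M₀) / (x / e₃))) +
      S.re * (1024 * (L + 1) * (d₁ + d₂ + 1) *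
        (((e₁ : ℝ) ^ (-α) * M₀) * ((e₂ : ℝ) ^ (-α) * M₀) * ((e₃ : ℝ) ^ (-α) * M₀) / (x / e₃)) *
          (1 / (x / e₁) + 1 / (x / e₂) + 1 / (x / e₃))) := by
  have hp0 : (0 : ℝ) < p := by exact_mod_cast (show 0 < p by omega)
  have he₁0 : (0 : ℝ) < e₁ := by exact_mod_cast (show 0 < e₁ by omega)
  have he₂0 : (0 : ℝ) < e₂ := by exact_mod_cast (show 0 < e₂ by omega)
  have he₃0 : (0 : ℝ) < e₃ := by exact_mod_cast (show 0 < e₃ by omega)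
  have hX₃ : 0 < x / e₃ := div_pos hx he₃0
  -- rewrite the asymptotic at `e_i p` in the rescaled shape
  have hsc : ∀ e : ℕ, x / ((e * p : ℕ) : ℝ) = x / e / p := fun e => by rw [Nat.cast_mul, div_div]
  have hms : ∀ e : ℕ, ((e * p : ℕ) : ℝ) ^ (-α) * M₀ = (p : ℝ) ^ (-α) * ((e : ℝ) ^ (-α) * M₀) := fun e => by
    rw [Nat.cast_mul, Real.mul_rpow (Nat.cast_nonneg _) (Nat.cast_nonneg _)]; ring
  rw [hsc, hsc, hsc, hms, hms, hms] at hAp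
  have hr : ε * (((p : ℝ) ^ (-α) * ((e₁ : ℝ) ^ (-α) * M₀)) * ((p : ℝ) ^ (-α) * ((e₂ : ℝ) ^ (-α) * M₀)) *
        ((p : ℝ) ^ (-α) * ((e₃ : ℝ) ^ (-α) * M₀))) / (x / e₃ / p) =
      ε * ((p : ℝ) * ((p : ℝ) ^ (-α)) ^ 3) *
        (((e₁ : ℝ) ^ (-α) * M₀) * ((e₂ : ℝ) ^ (-α) * M₀) * ((e₃ : ℝ) ^ (-α) * M₀) / (x / e₃)) := by
    field_simp
  rw [hr] at hAp
  -- the exact rescaling and the sublattice density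
  have hMv₁ : 0 ≤ (e₁ : ℝ) ^ (-α) * M₀ := by positivity
  have hMv₂ : 0 ≤ (e₂ : ℝ) ^ (-α) * M₀ := by positivity
  have hMv₃ : 0 ≤ (e₃ : ℝ) ^ (-α) * M₀ := by positivity
  have hresc := norm_parityModelCount_rescale_sub_le' hσ d₁ d₂ hα0 hα1 hMv₁ hMv₂ hMv₃ hX₃ (show 0 < p by omega) hpX₁ hpX₂
    hz₁ hz₂ hz₃ hle₁ hle₂ hle₃ hL₁ hL₂ hL₃ (c₁ := c₁) (c₂ := c₂) (c₃ := c₃) (σ := σ)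
  have hcast : (p : ℂ) * (((p : ℝ) ^ (-α) : ℝ) : ℂ) ^ 3 = (((p : ℝ) * ((p : ℝ) ^ (-α)) ^ 3 : ℝ) : ℂ) := by push_cast; ring
  rw [hcast] at hresc
  have key := re_le_of_asymptotic_rescale hS hS0 hAp hresc
  refine key.trans (add_le_add le_rfl (mul_le_mul_of_nonneg_left ?_ hS0))
  -- `r_p · (… p …) ≤ (…)` since `r_p p ≤ 1`
  have hQ0 : 0 ≤ ((e₁ : ℝ) ^ (-α) * M₀) * ((e₂ : ℝ) ^ (-α) * M₀) * ((e₃ : ℝ) ^ (-α) * M₀) / (x / e₃) := by positivity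
  have hinv0 : 0 ≤ 1 / (x / e₁) + 1 / (x / e₂) + 1 / (x / e₃) := by positivity
  have hrp := rweight_mul_le_one hp hα23
  calc (p : ℝ) * ((p : ℝ) ^ (-α)) ^ 3 * (1024 * (L + 1) * (d₁ + d₂ + 1) * p *
        (((e₁ : ℝ) ^ (-α) * M₀) * ((e₂ : ℝ) ^ (-α) * M₀) * ((e₃ : ℝ) ^ (-α) * M₀) / (x / e₃)) *
          (1 / (x / e₁) + 1 / (x / e₂) + 1 / (x / e₃)))
      = ((p : ℝ) * ((p : ℝ) ^ (-α)) ^ 3 * p) * (1024 * (L + 1) * (d₁ + d₂ + 1) *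
        (((e₁ : ℝ) ^ (-α) * M₀) * ((e₂ : ℝ) ^ (-α) * M₀) * ((e₃ : ℝ) ^ (-α) * M₀) / (x / e₃)) *
          (1 / (x / e₁) + 1 / (x / e₂) + 1 / (x / e₃))) := by ring
    _ ≤ 1 * (1024 * (L + 1) * (d₁ + d₂ + 1) *
        (((e₁ : ℝ) ^ (-α) * M₀) * ((e₂ : ℝ) ^ (-α) * M₀) * ((e₃ : ℝ) ^ (-α) * M₀) / (x / e₃)) *
          (1 / (x / e₁) + 1 / (x / e₂) + 1 / (x / e₃))) := mul_le_mul_of_nonneg_right hrp (by positivity)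
    _ = _ := one_mul _

end Sieved

open Sieved

set_option maxHeartbeats 4000000 in
/-- **THE ANALYTIC PART OF THE SIEVED LOWER BOUND (main term and small sieving primes).**  See the module docstring:
for real nonnegative plateau profiles, in the polylog regime `y = ⌊(log x)^{100000}⌋`, for all large `x` and all
bounded data, `re W(X) − Σ_{3 ≤ p ≤ (log x)^{180}, p prime} re W(X/p) ≥ (2/25)(b₁−a₁)(b₂−a₂) · Mv₁Mv₂Mv₃/(x/e₃)`.
[cite: Harper2016, §5] [cite: LagariasSoundararajan2012, Thm 1.3 (shape)] -/
theorem parityTernary_sieved_small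
    (hF : ∀ ε : ℝ, 0 < ε → ∃ C : ℝ, 0 < C ∧ ∀ (q : ℕ) (χ : DirichletCharacter ℂ q), q ≠ 0 → χ ≠ 1 →
      ∀ (y : ℕ) (X lam : ℝ), 1 ≤ X →
        ‖∑ n ∈ Nat.smoothNumbersUpTo ⌊X⌋₊ (y + 1), χ (n : ZMod q) * twistWeight lam (n / X)‖ ≤
          C * (1 + |lam|) ^ 3 * X ^ (1 / 2 + ε) * (q : ℝ) ^ ε)
    (hD : FriableZetaLongRangeDecay) (D₀ E₀ : ℕ) {L a₁ b₁ a₂ b₂ a₃ b₃ : ℝ} {c₁ c₂ c₃ : ℤ → ℂ}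
    (hc₁ : Summable (fun ℓ : ℤ => ‖c₁ ℓ‖ * (1 + |(ℓ : ℝ)|) ^ 3)) (hc₂ : Summable (fun ℓ : ℤ => ‖c₂ ℓ‖ * (1 + |(ℓ : ℝ)|) ^ 3))
    (hc₃ : Summable (fun ℓ : ℤ => ‖c₃ ℓ‖ * (1 + |(ℓ : ℝ)|) ^ 3))
    (hre₁ : ∀ v : ℝ, (profileFn c₁ v).im = 0) (hre₂ : ∀ v : ℝ, (profileFn c₂ v).im = 0)
    (hre₃ : ∀ v : ℝ, (profileFn c₃ v).im = 0)
    (hnn₁ : ∀ v : ℝ, 0 ≤ (profileFn c₁ v).re) (hnn₂ : ∀ v : ℝ, 0 ≤ (profileFn c₂ v).re)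
    (hnn₃ : ∀ v : ℝ, 0 ≤ (profileFn c₃ v).re)
    (hle₁ : ∀ v : ℝ, ‖profileFn c₁ v‖ ≤ 1) (hle₂ : ∀ v : ℝ, ‖profileFn c₂ v‖ ≤ 1) (hle₃ : ∀ v : ℝ, ‖profileFn c₃ v‖ ≤ 1)
    (hz₁ : ∀ v : ℝ, v ≤ 1 / 4 → profileFn c₁ v = 0) (hz₂ : ∀ v : ℝ, v ≤ 1 / 4 → profileFn c₂ v = 0)
    (hz₃ : ∀ v : ℝ, v ≤ 1 / 4 → profileFn c₃ v = 0)
    (hL : 0 ≤ L) (hL₁ : ∀ v w : ℝ, ‖profileFn c₁ v - profileFn c₁ w‖ ≤ L * |v - w|)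
    (hL₂ : ∀ v w : ℝ, ‖profileFn c₂ v - profileFn c₂ w‖ ≤ L * |v - w|)
    (hL₃ : ∀ v w : ℝ, ‖profileFn c₃ v - profileFn c₃ w‖ ≤ L * |v - w|)
    (ha₁ : 0 < a₁) (hab₁ : a₁ < b₁) (hb₁ : b₁ ≤ 1) (ha₂ : 0 < a₂) (hab₂ : a₂ < b₂) (hb₂ : b₂ ≤ 1)
    (ha₃ : 0 < a₃) (hb₃ : b₃ ≤ 1)
    (hp₁ : ∀ v ∈ Set.Icc a₁ b₁, profileFn c₁ v = 1) (hp₂ : ∀ v ∈ Set.Icc a₂ b₂, profileFn c₂ v = 1)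
    (hp₃ : ∀ v ∈ Set.Icc a₃ b₃, profileFn c₃ v = 1) :
    ∀ᶠ x : ℝ in atTop, ∀ (σ : ℤ) (e₁ e₂ e₃ d₁ d₂ : ℕ),
      (σ = 1 ∨ σ = -1) → 1 ≤ e₁ → 1 ≤ e₂ → 1 ≤ e₃ → e₁ ≤ E₀ → e₂ ≤ E₀ → e₃ ≤ E₀ →
      1 ≤ d₁ → 1 ≤ d₂ → d₁ ≤ D₀ → d₂ ≤ D₀ → Even d₁ → Odd d₂ →
      (d₁ : ℝ) / e₁ + d₂ / e₂ + 1 / e₃ ≤ 1 →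
      (∀ n₁ n₂ : ℕ, a₁ * (x / e₁) ≤ n₁ → (n₁ : ℝ) ≤ b₁ * (x / e₁) → a₂ * (x / e₂) ≤ n₂ → (n₂ : ℝ) ≤ b₂ * (x / e₂) →
          a₃ * (x / e₃) ≤ (d₁ * n₁ : ℝ) + σ * (d₂ * n₂) ∧ (d₁ * n₁ : ℝ) + σ * (d₂ * n₂) ≤ b₃ * (x / e₃)) →
      2 / 25 * ((b₁ - a₁) * (b₂ - a₂)) * (((e₁ : ℝ) ^ (-saddlePoint x ⌊Real.log x ^ 100000⌋₊) * (x ^ saddlePoint x ⌊Real.log x ^ 100000⌋₊ * smoothZeta (saddlePoint x ⌊Real.log x ^ 100000⌋₊) ⌊Real.log x ^ 100000⌋₊ / Real.sqrt (2 * Real.pi * saddlePhi₂ (saddlePoint x ⌊Real.log x ^ 100000⌋₊) ⌊Real.log x ^ 100000⌋₊))) * ((e₂ : ℝ) ^ (-saddlePoint x ⌊Real.log x ^ 100000⌋₊) * (x ^ saddlePoint x ⌊Real.log x ^ 100000⌋₊ * smoothZeta (saddlePoint x ⌊Real.log x ^ 100000⌋₊) ⌊Real.log x ^ 100000⌋₊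 / Real.sqrt (2 * Real.pi * saddlePhi₂ (saddlePoint x ⌊Real.log x ^ 100000⌋₊) ⌊Real.log x ^ 100000⌋₊))) * ((e₃ : ℝ) ^ (-saddlePoint x ⌊Real.log x ^ 100000⌋₊) * (x ^ saddlePoint x ⌊Real.log x ^ 100000⌋₊ * smoothZeta (saddlePoint x ⌊Real.log x ^ 100000⌋₊) ⌊Real.log x ^ 100000⌋₊ / Real.sqrt (2 * Real.pi * saddlePhi₂ (saddlePoint x ⌊Real.log x ^ 100000⌋₊) ⌊Real.log x ^ 100000⌋₊)))) / (x / e₃) ≤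
        (parityTernarySum ⌊Real.log x ^ 100000⌋₊ σ d₁ d₂ (x / e₁) (x / e₂) (x / e₃) c₁ c₂ c₃).re -
          ∑ p ∈ ((Finset.range (⌊Real.log x ^ 100000⌋₊ + 1)).filter (fun p => p.Prime ∧ 3 ≤ p)).filter (fun p : ℕ => (p : ℝ) ≤ Real.log x ^ 180),
            (parityTernarySum ⌊Real.log x ^ 100000⌋₊ σ d₁ d₂ (x / e₁ / p) (x / e₂ / p) (x / e₃ / p) c₁ c₂ c₃).re := by
  -- ### constants and the asymptotic
  set κ : ℝ := (b₁ - a₁) * (b₂ - a₂) with hκdef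
  have hκ : 0 < κ := mul_pos (by linarith) (by linarith)
  set P₀ : ℝ := max (profileNorm c₁) (max (profileNorm c₂) (profileNorm c₃)) with hP₀def
  obtain ⟨C_H, hC_H, hHc⟩ := parityHcSum3_le
  have hA := parityTernary_asymptotic hF hD D₀ 200 (by norm_num) (C_H * ((D₀ : ℝ) * D₀) * ((D₀ : ℝ) * D₀)) P₀ (κ / 200)
    (by positivity)
  obtain ⟨x₁, hlt1⟩ := saddlePoint_lt_one
  set Kj : ℝ := 9 * (D₀ : ℝ) ^ 2 * (1024 * (L + 1) * (2 * D₀ + 1) * (3 * E₀)) * 2 with hKjdef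
  have hKj : 0 ≤ Kj := by positivity
  have EJ : ∀ᶠ x : ℝ in atTop, Real.log x ^ 180 ≤ κ / 400 / (Kj + 1) * x ^ (1 : ℝ) :=
    eventually_log_pow_le_mul_rpow 180 one_pos (by positivity)
  have EE : ∀ᶠ x : ℝ in atTop, (E₀ : ℝ) ≤ Real.log x := Real.tendsto_log_atTop.eventually_ge_atTop _
  have EX : ∀ᶠ x : ℝ in atTop, max (10 * E₀ / (b₁ - a₁)) (10 * E₀ / (b₂ - a₂)) ≤ x := eventually_ge_atTop _
  filter_upwards [hA, polylog_regime_basic, polylog_regime_real_scales x₁, EJ, EE, EX] with x hA hb hreg hJx hEL hX10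
    σ e₁ e₂ e₃ d₁ d₂ hσ he₁ he₂ he₃ heE₁ heE₂ heE₃ hd₁ hd₂ hdD₁ hdD₂ hd₁e hd₂o hde hcomp
  -- ### the regime
  obtain ⟨hx1, hL2, hy2, hyK', -, hy4, -, hlogy6, -, h200, hsqx⟩ := hb
  obtain ⟨hxx₁, -, -, -, hα4, -, -, -⟩ := hreg x hsqx le_rfl
  clear hreg
  simp only [max_le_iff] at hX10
  obtain ⟨hX10₁, hX10₂⟩ := hX10
  set Lx : ℝ := Real.log x with hLx
  set y : ℕ := ⌊Lx ^ 100000⌋₊ with hy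
  set α : ℝ := saddlePoint x y with hαdef
  set M₀ : ℝ := x ^ α * smoothZeta α y / Real.sqrt (2 * Real.pi * saddlePhi₂ α y) with hM₀def
  have hx0 : 0 < x := by linarith
  have hL1 : 1 ≤ Lx := by linarith
  have hL0 : 0 ≤ Lx := by linarith
  have hy1 : 1 ≤ y := by omega
  have hy1r : (1 : ℝ) ≤ y := by exact_mod_cast hy1
  have hyx : (y : ℝ) ≤ x := ((le_self_pow₀ hy1r (by norm_num)).trans h200).trans hsqx
  have hα1 : α < 1 := by
    refine hlt1 x y hxx₁ ((pow_le_pow_right₀ hL1 (by norm_num)).trans hy4) hyx ?_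
    have : (0 : ℝ) ≤ Lx ^ (1 / 6 : ℝ) := Real.rpow_nonneg hL0 _
    linarith
  have hα0 : 0 < α := by linarith
  have hα13 : 13 / 15 < α := by linarith
  have hα23 : 2 / 3 ≤ α := by linarith
  have hζ := smoothZeta_pos (y := y) hα0
  have hφ : 0 < saddlePhi₂ α y := lt_of_lt_of_le (by norm_num) (fifth_le_saddlePhi₂ hy2 hα0 (by linarith))
  have hM₀ : 0 < M₀ := by positivity
  -- ### scalings
  have he₁1 : (1 : ℝ) ≤ e₁ := by exact_mod_cast he₁
  have he₂1 : (1 : ℝ) ≤ e₂ := by exact_mod_cast he₂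
  have he₃1 : (1 : ℝ) ≤ e₃ := by exact_mod_cast he₃
  have heE₁r : (e₁ : ℝ) ≤ E₀ := by exact_mod_cast heE₁
  have heE₂r : (e₂ : ℝ) ≤ E₀ := by exact_mod_cast heE₂
  have heE₃r : (e₃ : ℝ) ≤ E₀ := by exact_mod_cast heE₃
  have hE1 : (1 : ℝ) ≤ E₀ := he₁1.trans heE₁r
  have hE0 : (0 : ℝ) < E₀ := by linarith
  have hX₁ : 0 < x / e₁ := by positivity
  have hX₂ : 0 < x / e₂ := by positivity
  have hX₃ : 0 < x / e₃ := by positivity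
  -- `L^180 ≤ y ≤ √x ≤ x/E₀ ≤ x/e_i`
  have hEsq : (E₀ : ℝ) ≤ x ^ (1 / 2 : ℝ) :=
    (hEL.trans ((le_self_pow₀ hL1 (by norm_num)).trans hy4)).trans ((le_self_pow₀ hy1r (by norm_num)).trans h200)
  have hsqE : x ^ (1 / 2 : ℝ) ≤ x / E₀ := by
    rw [le_div_iff₀ hE0]
    calc x ^ (1 / 2 : ℝ) * E₀ ≤ x ^ (1 / 2 : ℝ) * x ^ (1 / 2 : ℝ) :=
          mul_le_mul_of_nonneg_left hEsq (Real.rpow_nonneg hx0.le _)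
      _ = x := by rw [← Real.rpow_add hx0]; norm_num
  have h180y : Lx ^ 180 ≤ y := by
    have hsplit : Lx ^ 100000 = Lx ^ 180 * Lx ^ 99820 := by rw [← pow_add]
    have hbig : 2 ≤ Lx ^ 99820 := hL2.trans (le_self_pow₀ hL1 (by norm_num))
    have : 2 * Lx ^ 180 ≤ Lx ^ 100000 := by rw [hsplit]; nlinarith [pow_nonneg hL0 180]
    linarith
  have h180 : Lx ^ 180 ≤ x / E₀ := (h180y.trans ((le_self_pow₀ hy1r (by norm_num)).trans h200)).trans hsqE
  have hXE : ∀ {e : ℕ}, 1 ≤ e → e ≤ E₀ → x / E₀ ≤ x / e := fun he heE =>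
    div_le_div_of_nonneg_left hx0.le (by exact_mod_cast (show 0 < _ by omega)) (by exact_mod_cast heE)
  have hL20 : (E₀ : ℝ) ≤ Lx ^ 20 := hEL.trans (le_self_pow₀ hL1 (by norm_num))
  have heB : ∀ {e : ℕ}, e ≤ E₀ → (e : ℝ) ≤ Lx ^ 200 := fun heE =>
    ((show (_ : ℝ) ≤ E₀ by exact_mod_cast heE).trans hL20).trans (pow_le_pow_right₀ hL1 (by norm_num))
  have hepB : ∀ {e p : ℕ}, e ≤ E₀ → (p : ℝ) ≤ Lx ^ 180 → ((e * p : ℕ) : ℝ) ≤ Lx ^ 200 := by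
    intro e p heE hpL
    push_cast
    calc (e : ℝ) * p ≤ Lx ^ 20 * Lx ^ 180 :=
          mul_le_mul ((show (e : ℝ) ≤ E₀ by exact_mod_cast heE).trans hL20) hpL (Nat.cast_nonneg _) (by positivity)
      _ = Lx ^ 200 := by rw [← pow_add]
  -- ### the majorant sums, the profile norms
  have hd₁0 : d₁ ≠ 0 := by omega
  have hd₂0 : d₂ ≠ 0 := by omega
  have hdτ : ∀ {d : ℕ}, d ≤ D₀ → (d : ℝ) * ((Nat.divisors d).card : ℝ) ≤ (D₀ : ℝ) * D₀ := by
    intro d hd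
    have h : d * (Nat.divisors d).card ≤ D₀ * D₀ := Nat.mul_le_mul hd ((Nat.card_divisors_le_self d).trans hd)
    exact_mod_cast h
  have hH : ∀ R : ℕ, ∑ k ∈ Icc 1 R, ∑ a ∈ (Finset.range k).filter (Nat.Coprime k),
      classLocalHc α 2 1 k (d₁ * a) * classLocalHc α 2 1 k (σ * (d₂ * a)) * classLocalHc α 1 0 k a ≤
        C_H * ((D₀ : ℝ) * D₀) * ((D₀ : ℝ) * D₀) := by
    intro R
    refine (hHc α hα4 hα1.le σ hσ d₁ d₂ hd₁0 hd₂0 R).trans ?_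
    have h0 : 0 ≤ (d₂ : ℝ) * ((Nat.divisors d₂).card : ℝ) := by positivity
    exact mul_le_mul (mul_le_mul_of_nonneg_left (hdτ hdD₁) hC_H.le) (hdτ hdD₂) h0 (by positivity)
  have hP₁ : profileNorm c₁ ≤ P₀ := le_max_left _ _
  have hP₂ : profileNorm c₂ ≤ P₀ := (le_max_left _ _).trans (le_max_right _ _)
  have hP₃ : profileNorm c₃ ≤ P₀ := (le_max_right _ _).trans (le_max_right _ _)
  -- ### the singular series
  have hSim := paritySingSeries_im hα13 hα1.le hσ hd₁0 hd₁e hd₂o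
  have hSlo : 249 / 1000 ≤ (paritySingSeries α σ d₁ d₂).re :=
    (singLower_ge hα4).trans (le_paritySingSeries_re hα13 hα1.le hσ hd₁0 hd₁e hd₂o)
  have hS0 : 0 ≤ (paritySingSeries α σ d₁ d₂).re := by linarith
  have hShi : (paritySingSeries α σ d₁ d₂).re ≤ 9 * (D₀ : ℝ) ^ 2 :=
    (Complex.re_le_norm _).trans ((norm_paritySingSeries_le hα13 hα1.le hσ hd₁0 hd₁e hd₂o).trans
      (singUpper_le hα4 hα1.le hd₁ hd₂ hdD₁ hdD₂))
  -- ### the main term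
  have hmain := hA σ e₁ e₂ e₃ d₁ d₂ c₁ c₂ c₃ hσ he₁ he₂ he₃ (heB heE₁) (heB heE₂) (heB heE₃) hd₁ hd₂ hdD₁ hdD₂ hd₁e hd₂o
    hde hc₁ hc₂ hc₃ hP₁ hP₂ hP₃ hle₁ hle₂ hle₃ hH
  rw [mul_div_assoc] at hmain ⊢
  set Q : ℝ := ((e₁ : ℝ) ^ (-α) * M₀) * ((e₂ : ℝ) ^ (-α) * M₀) * ((e₃ : ℝ) ^ (-α) * M₀) / (x / e₃) with hQdef
  set MC : ℂ := parityModelCount σ d₁ d₂ (x / e₁) (x / e₂) (x / e₃) ((e₁ : ℝ) ^ (-α) * M₀) ((e₂ : ℝ) ^ (-α) * M₀)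
    ((e₃ : ℝ) ^ (-α) * M₀) α c₁ c₂ c₃ with hMCdef
  have hMv₁ : 0 ≤ (e₁ : ℝ) ^ (-α) * M₀ := by positivity
  have hMv₂ : 0 ≤ (e₂ : ℝ) ^ (-α) * M₀ := by positivity
  have hMv₃ : 0 ≤ (e₃ : ℝ) ^ (-α) * M₀ := by positivity
  have hQ0 : 0 ≤ Q := by positivity
  have hW := re_ge_of_asymptotic hSim hmain
  clear hmain
  -- ### the model count
  have hMClo : 81 / 100 * κ * Q ≤ MC.re := by
    have h10 : ∀ {e : ℕ} {u : ℝ}, 1 ≤ e → e ≤ E₀ → 0 < u → 10 * E₀ / u ≤ x → 10 ≤ u * (x / e) := by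
      intro e u he heE hu hux
      rw [div_le_iff₀ hu] at hux
      have h1 : u * (x / E₀) ≤ u * (x / e) := mul_le_mul_of_nonneg_left (hXE he heE) hu.le
      have h2 : 10 ≤ u * (x / E₀) := by rw [mul_div_assoc', le_div_iff₀ hE0]; linarith
      linarith
    have hpl := le_parityModelCount_re_of_plateau hre₁ hre₂ hre₃ hnn₁ hnn₂ hnn₃ σ d₁ d₂ hMv₁ hMv₂ hMv₃ hX₁ hX₂ hX₃
      hα1.le hp₁ hp₂ hp₃ ha₁ hb₁ ha₂ hb₂ ha₃ hb₃ (by linarith [h10 he₂ heE₂ (sub_pos.2 hab₂) hX10₂]) hcomp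
    exact (plateau_core_ge hMv₁ hMv₂ hMv₃ hX₁ hX₂ hX₃ (h10 he₁ heE₁ (sub_pos.2 hab₁) hX10₁)
      (h10 he₂ heE₂ (sub_pos.2 hab₂) hX10₂)).trans hpl
  -- ### the small sieving primes, one at a time
  set SM := ((Finset.range (y + 1)).filter (fun p => p.Prime ∧ 3 ≤ p)).filter (fun p : ℕ => (p : ℝ) ≤ Lx ^ 180)
    with hSMdef
  set J₁ : ℝ := 1024 * (L + 1) * (d₁ + d₂ + 1) * Q * (1 / (x / e₁) + 1 / (x / e₂) + 1 / (x / e₃)) with hJ₁def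
  have hpt : ∀ p ∈ SM, (parityTernarySum y σ d₁ d₂ (x / e₁ / p) (x / e₂ / p) (x / e₃ / p) c₁ c₂ c₃).re ≤
      (p : ℝ) * ((p : ℝ) ^ (-α)) ^ 3 * ((paritySingSeries α σ d₁ d₂).re * MC.re + κ / 200 * Q) +
        (paritySingSeries α σ d₁ d₂).re * J₁ := by
    intro p hp
    simp only [hSMdef, Finset.mem_filter, Finset.mem_range] at hp
    obtain ⟨⟨-, hpp, -⟩, hpL⟩ := hp
    have hp1 : 1 ≤ p := hpp.one_lt.le
    have hAp := hA σ (e₁ * p) (e₂ * p) (e₃ * p) d₁ d₂ c₁ c₂ c₃ hσ (one_le_mul he₁ hp1) (one_le_mul he₂ hp1)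
      (one_le_mul he₃ hp1) (hepB heE₁ hpL) (hepB heE₂ hpL) (hepB heE₃ hpL) hd₁ hd₂ hdD₁ hdD₂ hd₁e hd₂o
      (dil_sum_mul_le hp1 he₁ he₂ he₃ hde) hc₁ hc₂ hc₃ hP₁ hP₂ hP₃ hle₁ hle₂ hle₃ hH
    have key := re_small_prime_le hσ hx0 hα0.le hα23 hα1.le hM₀.le he₁ he₂ he₃ hp1
      (hpL.trans (h180.trans (hXE he₁ heE₁))) (hpL.trans (h180.trans (hXE he₂ heE₂))) hz₁ hz₂ hz₃ hle₁ hle₂ hle₃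
      hL hL₁ hL₂ hL₃ hSim hS0 hAp
    have hsc : ∀ e : ℕ, x / ((e * p : ℕ) : ℝ) = x / e / p := fun e => by rw [Nat.cast_mul, div_div]
    rw [hsc, hsc, hsc, ← hQdef, ← hMCdef, ← hJ₁def] at key
    exact key
  -- ### summing over the small primes
  have hsum : ∑ p ∈ SM, (parityTernarySum y σ d₁ d₂ (x / e₁ / p) (x / e₂ / p) (x / e₃ / p) c₁ c₂ c₃).re ≤
      (∑ p ∈ SM, (p : ℝ) * ((p : ℝ) ^ (-α)) ^ 3) * ((paritySingSeries α σ d₁ d₂).re * MC.re + κ / 200 * Q) +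
        (SM.card : ℝ) * ((paritySingSeries α σ d₁ d₂).re * J₁) := by
    refine (Finset.sum_le_sum hpt).trans (le_of_eq ?_)
    rw [Finset.sum_add_distrib, Finset.sum_mul, Finset.sum_const, nsmul_eq_mul]
  have hS₁ : ∑ p ∈ SM, (p : ℝ) * ((p : ℝ) ^ (-α)) ^ 3 ≤ 501 / 1000 := by
    have hsub : SM ⊆ Finset.Ioc 2 ⌊Lx ^ 180⌋₊ := by
      intro p hp
      simp only [hSMdef, Finset.mem_filter, Finset.mem_range] at hp
      exact Finset.mem_Ioc.2 ⟨by omega, Nat.le_floor hp.2⟩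
    calc ∑ p ∈ SM, (p : ℝ) * ((p : ℝ) ^ (-α)) ^ 3 = ∑ p ∈ SM, (p : ℝ) ^ (-(3 * α - 1)) := by
          refine Finset.sum_congr rfl fun p hp => rweight_eq ?_ α
          simp only [hSMdef, Finset.mem_filter] at hp
          exact hp.1.2.1.pos
      _ ≤ ∑ n ∈ Finset.Ioc 2 ⌊Lx ^ 180⌋₊, (n : ℝ) ^ (-(3 * α - 1)) :=
          Finset.sum_le_sum_of_subset_of_nonneg hsub fun _ _ _ => by positivity
      _ ≤ ((2 : ℕ) : ℝ) ^ (1 - (3 * α - 1)) / ((3 * α - 1) - 1) := GPY.sum_Ioc_rpow_neg_le (by norm_num) (by linarith)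
      _ ≤ 501 / 1000 := by rw [Nat.cast_ofNat]; exact two_rpow_div_le (by linarith)
  have hcard : (SM.card : ℝ) ≤ 2 * Lx ^ 180 := by
    have h1 : SM ⊆ Finset.range (⌊Lx ^ 180⌋₊ + 1) := fun p hp => by
      simp only [hSMdef, Finset.mem_filter] at hp
      exact Finset.mem_range.2 (Nat.lt_succ_of_le (Nat.le_floor hp.2))
    have h2 : SM.card ≤ ⌊Lx ^ 180⌋₊ + 1 := (Finset.card_le_card h1).trans (Finset.card_range _).le
    have h3 : (⌊Lx ^ 180⌋₊ : ℝ) ≤ Lx ^ 180 := Nat.floor_le (by positivity)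
    have h4 : (1 : ℝ) ≤ Lx ^ 180 := one_le_pow₀ hL1
    calc (SM.card : ℝ) ≤ (⌊Lx ^ 180⌋₊ : ℝ) + 1 := by exact_mod_cast h2
      _ ≤ 2 * Lx ^ 180 := by linarith
  -- ### the junk of the small primes is `o(Q)`
  have hJ₁ : J₁ ≤ 1024 * (L + 1) * (2 * D₀ + 1) * Q * (3 * E₀ / x) := by
    have hinv : 1 / (x / e₁) + 1 / (x / e₂) + 1 / (x / e₃) ≤ 3 * E₀ / x := by
      rw [one_div_div, one_div_div, one_div_div, ← add_div, ← add_div]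
      exact div_le_div_of_nonneg_right (by linarith) hx0.le
    have hd : (d₁ : ℝ) + d₂ + 1 ≤ 2 * D₀ + 1 := by
      have h₁ : (d₁ : ℝ) ≤ D₀ := by exact_mod_cast hdD₁
      have h₂ : (d₂ : ℝ) ≤ D₀ := by exact_mod_cast hdD₂
      linarith
    have hinv0 : 0 ≤ 1 / (x / e₁) + 1 / (x / e₂) + 1 / (x / e₃) := by positivity
    rw [hJ₁def]
    exact mul_le_mul (mul_le_mul_of_nonneg_right (mul_le_mul_of_nonneg_left hd (by positivity)) hQ0) hinv hinv0
      (by positivity)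
  have hJ₁0 : 0 ≤ J₁ := by positivity
  have hJt : (SM.card : ℝ) * ((paritySingSeries α σ d₁ d₂).re * J₁) ≤ κ * Q / 400 := by
    rw [Real.rpow_one] at hJx
    have hKx : Kj * Lx ^ 180 ≤ κ / 400 * x := by
      have h1 := mul_le_mul_of_nonneg_left hJx hKj
      have h2 : Kj * (κ / 400 / (Kj + 1) * x) ≤ κ / 400 * x := by
        rw [show Kj * (κ / 400 / (Kj + 1) * x) = (Kj / (Kj + 1)) * (κ / 400 * x) by ring]
        exact mul_le_of_le_one_left (by positivity) ((div_le_one (by positivity)).2 (by linarith))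
      exact h1.trans h2
    calc (SM.card : ℝ) * ((paritySingSeries α σ d₁ d₂).re * J₁)
        ≤ (2 * Lx ^ 180) * (9 * (D₀ : ℝ) ^ 2 * (1024 * (L + 1) * (2 * D₀ + 1) * Q * (3 * E₀ / x))) :=
          mul_le_mul hcard (mul_le_mul hShi hJ₁ hJ₁0 (by positivity)) (by positivity) (by positivity)
      _ = (Kj * Lx ^ 180) * Q / x := by rw [hKjdef]; field_simp
      _ ≤ (κ / 400 * x) * Q / x := div_le_div_of_nonneg_right (mul_le_mul_of_nonneg_right hKx hQ0) hx0.le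
      _ = κ * Q / 400 := by field_simp
  -- ### conclusion
  exact sieved_arith hκ.le hQ0 hW hsum hS₁ hSlo hMClo hJt

end SmoothArcs

end Literature.NumberTheory.Sieve

end
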